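import Literature.Topology.FourManifolds.LatticeFormsReflectionGroupAbelianisationTwoGroup
import Literature.Topology.FourManifolds.LatticeFormsNegTwoVectorOrbitsOriented
import HarnessLib

/-!
# `(±2)`-vectors of an even unimodular lattice with two hyperbolic planes form ONE `SO⁺`-orbit; Prop. 1.6 and Cor. 1.2
# "with opposite signs" (the `(+2)`-reflections)
# (Gritsenko–Hulek–Sankaran, *J. Algebra* 322 (2009), Prop. 1.6 (proof), remark after Cor. 1.2, Thm. 1.3; GHS, *Doc. Math.* 13 (2008) Prop. 2.4 (i))

Trunk T-4MAN vocabulary. Rows g41-#1 / g46-#9 (`LatticeFormsNegTwoVectorOrbits(Oriented)`) give GHS 2008 Prop. 2.4 (i) for the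
`(−2)`-vectors of a symmetric even unimodular lattice with `n± ≥ 2` under `O(L)` and `O⁺(L)`. The printed proof of GHS 2009
Prop. 1.6 uses the sharper group: "there exists `g ∈ SO⁺(L)` such that `g(a) = b`" (the Eichler criterion produces elements
of `E(L) ⊆ S̃O⁺(L)`), and p. 3 notes that everything "is also true with opposite signs, i.e. if `L` contains at least one
`2`-vector and we consider the reflections `σ_a` with `a² = 2`". This file proves, for EVERY symmetric even unimodular lattice
with `n₊ ≥ 2` and `n₋ ≥ 2` (`II_{p,q} ⊇ U ⊕ U`) and EITHER sign `ε = ±1`: the `(2ε)`-vectors are primitive, any two of them are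
exchanged by an element of `SO⁺(L) = {g ∈ O⁺(L) : det g = 1}` (so by an element of every class `P ⊇ SO⁺(L)`), and the
opposite-sign consequences for the `(+2)`-reflections `σ_a ∈ ker(χ·det)` (`χ` the orientation character: `σ_a` has
`χ = det = −1`): `σ_aσ_b` is a word in commutators of `ker(χ·det)`, a word in `(+2)`-reflections is such a commutator word iff
its determinant is `1`, and — Thm. 1.3 with one orbit, row g51-#1 — under the opposite-sign Kneser hypothesis
`ker(χ·det) = ⟨σ_a : a² = 2⟩` (in the tree for `U^{⊕n}`, `n ≥ 3`, row g50-#8) the abelianisation of `ker(χ·det)` has order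
EXACTLY `2`. Written for lane `lit-hodgefound` (Track 2 foundations; prover seat `lit-hodgefound-p18`, gen 51, row g51-#2).
THEOREMS ONLY — no definition, no named fact, no instance, no notation.

## Sources, verbatim

* GHS 2009 (held `paper:arxiv-0810.1614`) p. 4, proof of **Prop. 1.6**: "The orbit of a `(−2)`-vector `a` is determined by its
  image in the discriminant group (this is a case of the Eichler criterion, from [Ei]: see Proposition 3.3(i), below). But that
  group is trivial. Therefore there exists `g ∈ SO⁺(L)` such that `g(a) = b`. But then `σ_aσ_b = σ_aσ_{g(a)} = σ_a g σ_a g⁻¹` is a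
  commutator." p. 3, after **Cor. 1.2** (`O'(L) = S̃O⁺(L)`): "Note that Corollary 1.2 is also true with opposite signs, i.e. if
  `L` contains at least one `2`-vector and we consider the reflections `σ_a` with `a² = 2`. To see this, simply multiply the
  quadratic form of the lattice `L` by `−1`." **Thm. 1.3**: "`Õ⁺(L)^{ab}` […] is an abelian `2`-group. Its order divides `2^N`
  […] where `N` is the number of different `Õ⁺(L)`-orbits […] of `(−2)`-vectors".
* GHS 2008 (held `paper:arxiv-math_0609774`) Prop. 2.4 (i) and its proof: "Any two `(−2)`-vectors in the lattice `II_{2,8m+2}`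
  are equivalent modulo `O⁺(II_{2,8m+2})` […] the `Õ⁺(L)`-orbit of a primitive vector `l ∈ L` is completely defined by two
  invariants: by its length `(l,l)` and by its image `l* + L` in the discriminant group […] If `u` is a primitive vector of an
  even unimodular lattice […] then `div(u) = 1`".

## Contents (all proved)

* §1 (even lattice on a torsion-free module, `ε² = 1`) `(2ε)`-vectors are nonzero and primitive.
* §2 (symmetric even unimodular, `n± ≥ 2`) two orthogonal hyperbolic planes contain, orthogonal to any `h`, a `(−2)`-vector and
  a `(2ε)`-vector; any two `(2ε)`-vectors are `O`-equivalent (Eichler criterion), **`SO⁺`-equivalent**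
  (`exists_isometryEquiv_specialOrthogonal_apply_eq_of_apply_self_eq`; adjust `χ` by `σ_u`, `u² = 2`, `u ⊥ b`, then `det` by
  `σ_v`, `v² = −2`, `v ⊥ b`), `P`-equivalent for every `P ⊇ SO⁺`; the `(2ε)`-vectors form one `SO⁺`-orbit.
* §3 (`ε = 1`, `P = ker(χ·det)`) `ker(χ·det) ∋ 1, σ_a` is closed under composition and inverses and contains `SO⁺`;
  `σ_aσ_b ∈ [ker(χ·det), ker(χ·det)]`-words; words in `(+2)`-reflections: commutator words iff `det = 1`; under
  `ker(χ·det) = ⟨σ_a : a² = 2⟩`: `|ker(χ·det)^{ab}| ∣ 2`, in fact `= 2`; unconditionally for `U^{⊕n}`, `n ≥ 3`.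
-/

noncomputable section

open Module
open LinearMap (BilinForm)
open LinearMap.BilinForm
open LinearMap.BilinForm (IsometryEquiv)

namespace Literature.Topology.FourManifolds

universe u

/-! ### §1 `(2ε)`-vectors are primitive -/

section Primitive

variable {V : Type*} [AddCommGroup V] (Q : BilinForm ℤ V)

/-- A `(2ε)`-vector (`ε² = 1`) is nonzero. [cite: GritsenkoHulekSankaran2008Proportionality, §2 (proof of Prop. 2.4)] -/
theorem ne_zero_of_apply_self_eq_of_mul_self_eq_one {r : V} {ε : ℤ} (hr : Q r r = ε + ε) (hε : ε * ε = 1) : r ≠ 0 := by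
  rintro rfl
  simp only [map_zero] at hr
  rcases mul_self_eq_one_iff.1 hε with h | h <;> simp [h] at hr

/-- **`(±2)`-vectors are primitive**: in an even lattice on a torsion-free module a vector `r` with `r² = 2ε`, `ε² = 1`, spans a
saturated line (`kw = ar` gives `k²·w² = 2εa²` with `w²` even, so `k² ∣ a²`, `k ∣ a`, `w ∈ ℤr`) — "If `u` is a primitive vector
of an even unimodular lattice […] then `div(u) = 1`" applies to every `(±2)`-vector.
[cite: GritsenkoHulekSankaran2008Proportionality, §2 (proof of Prop. 2.4)] [cite: GritsenkoHulekSankaran2009, Cor. 1.2 ("also true with opposite signs")] -/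
theorem mem_span_singleton_of_smul_mem_of_apply_self_eq_of_mul_self_eq_one [Module.IsTorsionFree ℤ V] (he : Q.IsEven)
    {r : V} {ε : ℤ} (hr : Q r r = ε + ε) (hε : ε * ε = 1) (k : ℤ) (w : V) (hk : k ≠ 0) (hw : k • w ∈ ℤ ∙ r) : w ∈ ℤ ∙ r := by
  obtain ⟨a, ha⟩ := Submodule.mem_span_singleton.1 hw
  obtain ⟨j, hj⟩ := he w
  -- `k² w² = a² r²`
  have h1 : k * k * Q w w = a * a * Q r r := by
    have h2 := congrArg (fun v ↦ Q v v) ha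
    simp only [map_zsmul, LinearMap.smul_apply, smul_eq_mul] at h2
    linarith
  rw [hr, hj] at h1
  have h1' : k * k * j = a * a * ε := by linarith
  have h3 : k ^ 2 ∣ a ^ 2 := ⟨ε * j, by linear_combination (-ε) * h1' + (-(a * a)) * hε⟩
  obtain ⟨b, rfl⟩ := (Int.pow_dvd_pow_iff two_ne_zero).1 h3
  have h4 : k • (w - b • r) = 0 := by rw [smul_sub, smul_smul, ha, sub_self]
  rw [smul_eq_zero_iff_right hk, sub_eq_zero] at h4
  exact Submodule.mem_span_singleton.2 ⟨b, h4.symm⟩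

end Primitive

/-! ### §2 One `SO⁺`-orbit of `(2ε)`-vectors in an even unimodular lattice with `n± ≥ 2` -/

section TwoU

variable {W : Type*} [AddCommGroup W] {B : BilinForm ℤ W} {x y x₁ y₁ : W}

/-- **Two orthogonal hyperbolic planes contain a `(−2)`-vector orthogonal to any given vector** (the `(+2)`-statement of row
g46-#4 for the form `−B`, whose hyperbolic pairs are `(x, −y)`, `(x₁, −y₁)`). [cite: GritsenkoHulekSankaran2009, §3.2 Lemma 3.2 (proof: "the elementary divisor theorem for 2 × 2 matrices") and Prop. 1.6 (proof)] -/
theorem TwoHyperbolicPairs.exists_apply_self_eq_neg_two_apply_eq_zero (hp : TwoHyperbolicPairs B x y x₁ y₁) (h : W) :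
    ∃ v : W, B v v = -1 + -1 ∧ B v h = 0 := by
  have hn : TwoHyperbolicPairs (-B) x (-y) x₁ (-y₁) :=
    { isSymm := ⟨fun a b ↦ by simp only [LinearMap.neg_apply, hp.isSymm.eq a b]⟩
      xx := by simp [hp.xx]
      yy := by simp [hp.yy]
      xy := by simp [hp.xy]
      x₁x₁ := by simp [hp.x₁x₁]
      y₁y₁ := by simp [hp.y₁y₁]
      x₁y₁ := by simp [hp.x₁y₁]
      xx₁ := by simp [hp.xx₁]
      xy₁ := by simp [hp.xy₁]
      yx₁ := by simp [hp.yx₁]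
      yy₁ := by simp [hp.yy₁] }
  obtain ⟨v, hvv, hvh⟩ := hn.exists_apply_self_eq_two_apply_eq_zero h
  simp only [LinearMap.neg_apply] at hvv hvh
  exact ⟨v, by linarith, by simpa using hvh⟩

/-- Two orthogonal hyperbolic planes contain a `(2ε)`-vector orthogonal to any given vector, for either sign `ε = ±1`.
[cite: GritsenkoHulekSankaran2009, §3.2 Lemma 3.2 (proof) and Cor. 1.2 ("also true with opposite signs")] -/
theorem TwoHyperbolicPairs.exists_apply_self_eq_apply_eq_zero_of_mul_self_eq_one (hp : TwoHyperbolicPairs B x y x₁ y₁) {ε : ℤ}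
    (hε : ε * ε = 1) (h : W) : ∃ v : W, B v v = ε + ε ∧ B v h = 0 := by
  rcases mul_self_eq_one_iff.1 hε with rfl | rfl
  · exact hp.exists_apply_self_eq_two_apply_eq_zero h
  · exact hp.exists_apply_self_eq_neg_two_apply_eq_zero h

/-- `x + εy` is a `(2ε)`-vector of the hyperbolic plane `⟨x, y⟩`. [cite: GritsenkoHulekSankaran2009, §3.1 ("(e + (2/(a,a)) f)")] -/
theorem TwoHyperbolicPairs.apply_self_add_smul (hp : TwoHyperbolicPairs B x y x₁ y₁) (ε : ℤ) :
    B (x + ε • y) (x + ε • y) = ε + ε := by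
  simp only [map_add, map_zsmul, LinearMap.add_apply, LinearMap.smul_apply, smul_eq_mul, hp.xx, hp.yy, hp.xy, hp.isSymm.eq y x]
  ring

end TwoU

section Unimodular

variable {V : Type u} [AddCommGroup V] [Module.Finite ℤ V] [Module.Free ℤ V] (Q : BilinForm ℤ V)

/-- **The Eichler criterion for `(±2)`-vectors: any two `(2ε)`-vectors of a symmetric even unimodular lattice with `n± ≥ 2`
are equivalent modulo `O(L)`** — both are primitive with a dual vector, of the same square, and the discriminant group is
trivial (Huybrechts' Cor. 14.1.10, the tree's `exists_isometryEquiv_apply_eq_of_apply_eq_one`).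
[cite: GritsenkoHulekSankaran2008Proportionality, Prop. 2.4 (i) (proof: "the Eichler criterion")] [cite: GritsenkoHulekSankaran2009, Prop. 1.6 (proof) and Cor. 1.2 ("also true with opposite signs")] -/
theorem exists_isometryEquiv_apply_eq_of_apply_self_eq_of_mul_self_eq_one (hs : Q.IsSymm) (hu : Q.IsUnimodular) (he : Q.IsEven)
    (h2 : 2 ≤ sigPos Q.toQuadraticMap) (h2' : 2 ≤ sigNeg Q.toQuadraticMap) {ε : ℤ} (hε : ε * ε = 1) {r s : V}
    (hr : Q r r = ε + ε) (hs' : Q s s = ε + ε) : ∃ φ : Q.IsometryEquiv Q, φ r = s := by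
  haveI : Q.IsPerfPair := hu
  obtain ⟨z, hz⟩ := exists_apply_eq_one_of_primitive (B := Q) (ne_zero_of_apply_self_eq_of_mul_self_eq_one Q hr hε)
    (mem_span_singleton_of_smul_mem_of_apply_self_eq_of_mul_self_eq_one Q he hr hε)
  obtain ⟨z', hz'⟩ := exists_apply_eq_one_of_primitive (B := Q) (ne_zero_of_apply_self_eq_of_mul_self_eq_one Q hs' hε)
    (mem_span_singleton_of_smul_mem_of_apply_self_eq_of_mul_self_eq_one Q he hs' hε)
  exact exists_isometryEquiv_apply_eq_of_apply_eq_one Q hs hu he h2 h2' (hr.trans hs'.symm) hz hz'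

/-- **"There exists `g ∈ SO⁺(L)` such that `g(a) = b`"** (proof of Prop. 1.6), for either sign: any two `(2ε)`-vectors `a, b` of
a symmetric even unimodular lattice with `n± ≥ 2` are exchanged by an isometry which preserves the orientation of the positive
directions and has determinant `1`. From an arbitrary `g` with `g(a) = b`: two orthogonal hyperbolic planes supply `u ⊥ b` with
`u² = 2` and `v ⊥ b` with `v² = −2`; `σ_u` (`χ = det = −1`) and `σ_v` (`χ = 1`, `det = −1`) fix `b` and correct `χ(g)`, `det g`.
[cite: GritsenkoHulekSankaran2009, Prop. 1.6 (proof) and Cor. 1.2 ("also true with opposite signs")] [cite: GritsenkoHulekSankaran2008Proportionality, Prop. 2.4 (i)] -/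
theorem exists_isometryEquiv_specialOrthogonal_apply_eq_of_apply_self_eq (hs : Q.IsSymm) (hu : Q.IsUnimodular) (he : Q.IsEven)
    (h2 : 2 ≤ sigPos Q.toQuadraticMap) (h2' : 2 ≤ sigNeg Q.toQuadraticMap) {ε : ℤ} (hε : ε * ε = 1) {r s : V}
    (hr : Q r r = ε + ε) (hs' : Q s s = ε + ε) :
    ∃ g : Q.IsometryEquiv Q, (g.IsOrientationPreserving ∧ LinearMap.det (g : V →ₗ[ℤ] V) = 1) ∧ g r = s := by
  have hnd := hu.nondegenerate
  obtain ⟨g₀, hg₀⟩ := exists_isometryEquiv_apply_eq_of_apply_self_eq_of_mul_self_eq_one Q hs hu he h2 h2' hε hr hs'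
  obtain ⟨x, y, x₁, y₁, hP⟩ := exists_twoHyperbolicPairs_of_isEven_of_isUnimodular Q hs hu he h2 h2'
  obtain ⟨u, huu, hus⟩ := hP.exists_apply_self_eq_two_apply_eq_zero s
  obtain ⟨v, hvv, hvs⟩ := hP.exists_apply_self_eq_neg_two_apply_eq_zero s
  -- step 1: the orientation character, corrected by `σ_u`
  obtain ⟨g₁, hg₁O, hg₁⟩ : ∃ g₁ : Q.IsometryEquiv Q, g₁.IsOrientationPreserving ∧ g₁ r = s := by
    by_cases hO : g₀.IsOrientationPreserving
    · exact ⟨g₀, hO, hg₀⟩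
    · refine ⟨g₀.trans (normTwoReflectionEquiv hs u 1 huu (one_mul 1)),
        LinearMap.BilinForm.IsometryEquiv.isOrientationPreserving_trans_of_not_of_not hs hnd hO ?_, ?_⟩
      · rw [isOrientationPreserving_normTwoReflectionEquiv_iff _ hs hnd]
        norm_num
      · rw [LinearMap.BilinForm.IsometryEquiv.trans_apply, hg₀, normTwoReflectionEquiv_apply, hus, mul_zero, zero_smul, sub_zero]
  -- step 2: the determinant, corrected by `σ_v`
  by_cases hd : LinearMap.det (g₁ : V →ₗ[ℤ] V) = 1
  · exact ⟨g₁, ⟨hg₁O, hd⟩, hg₁⟩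
  · refine ⟨g₁.trans (normTwoReflectionEquiv hs v (-1) hvv (by norm_num)), ⟨?_, ?_⟩, ?_⟩
    · exact (LinearMap.BilinForm.IsometryEquiv.isOrientationPreserving_trans_iff hs hnd _ _).2
        (iff_of_true ((isOrientationPreserving_normTwoReflectionEquiv_iff _ hs hnd v (-1) hvv _).2 rfl) hg₁O)
    · rw [IsometryEquiv.det_trans_eq_mul, det_normTwoReflectionEquiv _ hs]
      rcases LinearMap.BilinForm.IsometryEquiv.det_eq_one_or_eq_neg_one g₁ with h | h
      · exact absurd h hd
      · rw [h]
        norm_num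
    · rw [LinearMap.BilinForm.IsometryEquiv.trans_apply, hg₁, normTwoReflectionEquiv_apply, hvs, mul_zero, zero_smul, sub_zero]

/-- **`P`-equivalence of `(2ε)`-vectors for every class `P ⊇ SO⁺(L)`** (`P = O⁺`, `O`, `ker(χ·det)`, `SO`, …).
[cite: GritsenkoHulekSankaran2009, Prop. 1.6 (proof) and Thm. 1.3 (proof: "a ≡ b mod Õ⁺(L)")] -/
theorem exists_isometryEquiv_prop_apply_eq_of_apply_self_eq {P : Q.IsometryEquiv Q → Prop}
    (hSO : ∀ g : Q.IsometryEquiv Q, g.IsOrientationPreserving ∧ LinearMap.det (g : V →ₗ[ℤ] V) = 1 → P g) (hs : Q.IsSymm)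
    (hu : Q.IsUnimodular) (he : Q.IsEven) (h2 : 2 ≤ sigPos Q.toQuadraticMap) (h2' : 2 ≤ sigNeg Q.toQuadraticMap) {ε : ℤ}
    (hε : ε * ε = 1) {r s : V} (hr : Q r r = ε + ε) (hs' : Q s s = ε + ε) : ∃ g : Q.IsometryEquiv Q, P g ∧ g r = s := by
  obtain ⟨g, hg, hgr⟩ := exists_isometryEquiv_specialOrthogonal_apply_eq_of_apply_self_eq Q hs hu he h2 h2' hε hr hs'
  exact ⟨g, hSO g hg, hgr⟩

/-- **One `SO⁺`-orbit of `(2ε)`-vectors** in a symmetric even unimodular lattice with `n± ≥ 2` (a `(2ε)`-vector exists: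
`e + εf` in a hyperbolic plane). [cite: GritsenkoHulekSankaran2009, Prop. 1.6 (proof)] [cite: GritsenkoHulekSankaran2008Proportionality, Prop. 2.4 (i)] -/
theorem natCard_quot_isometryEquiv_specialOrthogonal_apply_self_eq_of_isUnimodular (hs : Q.IsSymm) (hu : Q.IsUnimodular)
    (he : Q.IsEven) (h2 : 2 ≤ sigPos Q.toQuadraticMap) (h2' : 2 ≤ sigNeg Q.toQuadraticMap) {ε : ℤ} (hε : ε * ε = 1) :
    Nat.card (Quot fun r s : {r : V // Q r r = ε + ε} ↦
      ∃ φ : Q.IsometryEquiv Q, (φ.IsOrientationPreserving ∧ LinearMap.det (φ : V →ₗ[ℤ] V) = 1) ∧ φ r.1 = s.1) = 1 := by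
  obtain ⟨x, y, x₁, y₁, hP⟩ := exists_twoHyperbolicPairs_of_isEven_of_isUnimodular Q hs hu he h2 h2'
  haveI : Nonempty (Quot fun r s : {r : V // Q r r = ε + ε} ↦
      ∃ φ : Q.IsometryEquiv Q, (φ.IsOrientationPreserving ∧ LinearMap.det (φ : V →ₗ[ℤ] V) = 1) ∧ φ r.1 = s.1) :=
    ⟨Quot.mk _ ⟨x + ε • y, hP.apply_self_add_smul ε⟩⟩
  haveI : Subsingleton (Quot fun r s : {r : V // Q r r = ε + ε} ↦
      ∃ φ : Q.IsometryEquiv Q, (φ.IsOrientationPreserving ∧ LinearMap.det (φ : V →ₗ[ℤ] V) = 1) ∧ φ r.1 = s.1) :=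
    ⟨by
      rintro ⟨a⟩ ⟨b⟩
      exact Quot.sound (exists_isometryEquiv_specialOrthogonal_apply_eq_of_apply_self_eq Q hs hu he h2 h2' hε a.2 b.2)⟩
  exact Nat.card_eq_one_iff_unique.2 ⟨inferInstance, inferInstance⟩

end Unimodular

/-! ### §3 Opposite signs: the `(+2)`-reflections and `ker(χ·det)` -/

section OppositeSigns

variable {V : Type u} [AddCommGroup V] [Module.Finite ℤ V] [Module.Free ℤ V] (Q : BilinForm ℤ V)

/-- `1 ∈ ker(χ·det)`. [cite: GritsenkoHulekSankaran2009, Cor. 1.2 ("also true with opposite signs")] -/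
theorem kerChiDet_refl :
    (LinearMap.BilinForm.IsometryEquiv.refl Q).IsOrientationPreserving ↔
      LinearMap.det ((LinearMap.BilinForm.IsometryEquiv.refl Q : Q.IsometryEquiv Q) : V →ₗ[ℤ] V) = 1 :=
  iff_of_true specialOrthogonal_refl.1 specialOrthogonal_refl.2

/-- `ker(χ·det)` is closed under composition (`χ` and `det` are characters; `Q` symmetric non-degenerate).
[cite: GritsenkoHulekSankaran2009, Cor. 1.2 ("also true with opposite signs") and Cor. 1.8] -/
theorem kerChiDet_trans (hQ : Q.IsSymm) (hnd : Q.Nondegenerate) (α β : Q.IsometryEquiv Q)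
    (hα : α.IsOrientationPreserving ↔ LinearMap.det (α : V →ₗ[ℤ] V) = 1)
    (hβ : β.IsOrientationPreserving ↔ LinearMap.det (β : V →ₗ[ℤ] V) = 1) :
    (α.trans β).IsOrientationPreserving ↔ LinearMap.det ((α.trans β : Q.IsometryEquiv Q) : V →ₗ[ℤ] V) = 1 := by
  rw [LinearMap.BilinForm.IsometryEquiv.isOrientationPreserving_trans_iff hQ hnd, IsometryEquiv.det_trans_eq_mul, hα, hβ]
  rcases LinearMap.BilinForm.IsometryEquiv.det_eq_one_or_eq_neg_one α with h | h <;>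
    rcases LinearMap.BilinForm.IsometryEquiv.det_eq_one_or_eq_neg_one β with h' | h' <;> simp [h, h']

/-- `ker(χ·det)` is closed under inverses. [cite: GritsenkoHulekSankaran2009, Cor. 1.2 ("also true with opposite signs") and Cor. 1.8] -/
theorem kerChiDet_symm (hQ : Q.IsSymm) (hnd : Q.Nondegenerate) (α : Q.IsometryEquiv Q)
    (hα : α.IsOrientationPreserving ↔ LinearMap.det (α : V →ₗ[ℤ] V) = 1) :
    α.symm.IsOrientationPreserving ↔ LinearMap.det ((α.symm : Q.IsometryEquiv Q) : V →ₗ[ℤ] V) = 1 := by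
  rw [LinearMap.BilinForm.IsometryEquiv.isOrientationPreserving_symm_iff hQ hnd, IsometryEquiv.det_symm_eq, hα]

/-- `SO⁺(L) ⊆ ker(χ·det)`. [cite: GritsenkoHulekSankaran2009, Cor. 1.2 and §1 ("S̃O⁺(L) = Õ⁺(L) ∩ SO(L)")] -/
theorem kerChiDet_of_specialOrthogonal (g : Q.IsometryEquiv Q) (hg : g.IsOrientationPreserving ∧ LinearMap.det (g : V →ₗ[ℤ] V) = 1) :
    g.IsOrientationPreserving ↔ LinearMap.det (g : V →ₗ[ℤ] V) = 1 :=
  iff_of_true hg.1 hg.2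

/-- **A `(+2)`-reflection lies in `ker(χ·det)`**: `χ(σ_a) = −1` (it reverses the orientation of the positive directions) and
`det σ_a = −1` (`Q` symmetric non-degenerate). [cite: GritsenkoHulekSankaran2009, §1 ("reflection with respect to a vector with negative norm fixes the connected component") and Cor. 1.2 ("opposite signs")] -/
theorem kerChiDet_posTwoReflection (hQ : Q.IsSymm) (hnd : Q.Nondegenerate) (a : V) (ha : Q a a = 1 + 1) :
    (normTwoReflectionEquiv hQ a 1 ha (one_mul 1)).IsOrientationPreserving ↔
      LinearMap.det ((normTwoReflectionEquiv hQ a 1 ha (one_mul 1) : Q.IsometryEquiv Q) : V →ₗ[ℤ] V) = 1 := by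
  rw [isOrientationPreserving_normTwoReflectionEquiv_iff _ hQ hnd, det_normTwoReflectionEquiv _ hQ]
  norm_num

/-- **Prop. 1.6 with opposite signs: `σ_aσ_b = σ_aσ_{g(a)} = σ_a g σ_a g⁻¹` is a commutator**, `g ∈ SO⁺(L) ⊆ ker(χ·det)`,
`σ_a ∈ ker(χ·det)` — for every symmetric even unimodular lattice with `n± ≥ 2` and all `(+2)`-vectors `a, b`, the product
`σ_aσ_b` is a word in commutators of elements of `ker(χ·det)`.
[cite: GritsenkoHulekSankaran2009, Prop. 1.6 (proof) and Cor. 1.2 ("also true with opposite signs")] -/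
theorem isWordIn_commutators_kerChiDet_posTwoReflection_trans_posTwoReflection_of_isUnimodular (hs : Q.IsSymm)
    (hu : Q.IsUnimodular) (he : Q.IsEven) (h2 : 2 ≤ sigPos Q.toQuadraticMap) (h2' : 2 ≤ sigNeg Q.toQuadraticMap) {a b : V}
    (ha : Q a a = 1 + 1) (hb : Q b b = 1 + 1) :
    IsWordIn {ψ : Q.IsometryEquiv Q | ∃ α β : Q.IsometryEquiv Q,
        (α.IsOrientationPreserving ↔ LinearMap.det (α : V →ₗ[ℤ] V) = 1) ∧
        (β.IsOrientationPreserving ↔ LinearMap.det (β : V →ₗ[ℤ] V) = 1) ∧ ψ = ((β.symm.trans α.symm).trans β).trans α}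
      ((normTwoReflectionEquiv hs a 1 ha (one_mul 1)).trans (normTwoReflectionEquiv hs b 1 hb (one_mul 1))) := by
  obtain ⟨g, hg, hgab⟩ := exists_isometryEquiv_specialOrthogonal_apply_eq_of_apply_self_eq Q hs hu he h2 h2' (one_mul 1) ha hb
  subst hgab
  exact isWordIn_commutators_normTwoReflectionEquiv_trans_map_of
    (P := fun α : Q.IsometryEquiv Q ↦ α.IsOrientationPreserving ↔ LinearMap.det (α : V →ₗ[ℤ] V) = 1) hs ha (one_mul 1) g hb
    (kerChiDet_of_specialOrthogonal Q g hg) (kerChiDet_posTwoReflection Q hs hu.nondegenerate a ha)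

/-- **Thm. 1.3 with opposite signs, one orbit**: for every symmetric even unimodular lattice with `n± ≥ 2`, a word in the
`(+2)`-reflections is a word in commutators of elements of `ker(χ·det)` iff its determinant is `1` (all `(+2)`-vectors are
`SO⁺`-equivalent). [cite: GritsenkoHulekSankaran2009, Thm. 1.3 (proof) and Cor. 1.2 ("also true with opposite signs")] -/
theorem isWordIn_commutators_kerChiDet_iff_det_eq_one_of_isWordIn_posTwoReflections_of_isUnimodular (hs : Q.IsSymm)
    (hu : Q.IsUnimodular) (he : Q.IsEven) (h2 : 2 ≤ sigPos Q.toQuadraticMap) (h2' : 2 ≤ sigNeg Q.toQuadraticMap)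
    {φ : Q.IsometryEquiv Q}
    (hφ : IsWordIn {ψ : Q.IsometryEquiv Q | ∃ (a : V) (ha : Q a a = 1 + 1), ψ = normTwoReflectionEquiv hs a 1 ha (one_mul 1)} φ) :
    IsWordIn {ψ : Q.IsometryEquiv Q | ∃ α β : Q.IsometryEquiv Q,
        (α.IsOrientationPreserving ↔ LinearMap.det (α : V →ₗ[ℤ] V) = 1) ∧
        (β.IsOrientationPreserving ↔ LinearMap.det (β : V →ₗ[ℤ] V) = 1) ∧ ψ = ((β.symm.trans α.symm).trans β).trans α} φ ↔
      LinearMap.det (φ : V →ₗ[ℤ] V) = 1 :=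
  isWordIn_commutators_iff_det_eq_one_of_isWordIn_reflections_of_forall_exists
    (P := fun α : Q.IsometryEquiv Q ↦ α.IsOrientationPreserving ↔ LinearMap.det (α : V →ₗ[ℤ] V) = 1) hs (ε := 1) (one_mul 1)
    (fun a ha ↦ kerChiDet_posTwoReflection Q hs hu.nondegenerate a ha)
    (fun _ _ ha hb ↦ exists_isometryEquiv_prop_apply_eq_of_apply_self_eq Q (kerChiDet_of_specialOrthogonal Q) hs hu he h2 h2'
      (one_mul 1) ha hb) hφ

/-- **Thm. 1.3 with opposite signs under the opposite-sign Kneser hypothesis `ker(χ·det) = ⟨σ_a : a² = 2⟩`: the order of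
`ker(χ·det)^{ab}` divides `2`** (one `SO⁺`-orbit of `(+2)`-vectors; a `(+2)`-vector `e + f` exists), for every symmetric even
unimodular lattice with `n± ≥ 2`. [cite: GritsenkoHulekSankaran2009, Thm. 1.3 and Cor. 1.2 ("also true with opposite signs")] -/
theorem natCard_quot_kerChiDet_commutators_dvd_two_of_isUnimodular (hs : Q.IsSymm) (hu : Q.IsUnimodular) (he : Q.IsEven)
    (h2 : 2 ≤ sigPos Q.toQuadraticMap) (h2' : 2 ≤ sigNeg Q.toQuadraticMap)
    (hK : ∀ φ : Q.IsometryEquiv Q, (φ.IsOrientationPreserving ↔ LinearMap.det (φ : V →ₗ[ℤ] V) = 1) →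
      IsWordIn {ψ : Q.IsometryEquiv Q | ∃ (a : V) (ha : Q a a = 1 + 1), ψ = normTwoReflectionEquiv hs a 1 ha (one_mul 1)} φ) :
    Nat.card (Quot fun φ ρ : {φ : Q.IsometryEquiv Q // φ.IsOrientationPreserving ↔ LinearMap.det (φ : V →ₗ[ℤ] V) = 1} ↦
      IsWordIn {ψ : Q.IsometryEquiv Q | ∃ α β : Q.IsometryEquiv Q,
        (α.IsOrientationPreserving ↔ LinearMap.det (α : V →ₗ[ℤ] V) = 1) ∧
        (β.IsOrientationPreserving ↔ LinearMap.det (β : V →ₗ[ℤ] V) = 1) ∧ ψ = ((β.symm.trans α.symm).trans β).trans α}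
        (φ.1.trans ρ.1.symm)) ∣ 2 := by
  have hnd := hu.nondegenerate
  obtain ⟨x, y, x₁, y₁, hP⟩ := exists_twoHyperbolicPairs_of_isEven_of_isUnimodular Q hs hu he h2 h2'
  have hr₀ : Q (x + (1 : ℤ) • y) (x + (1 : ℤ) • y) = 1 + 1 := hP.apply_self_add_smul 1
  exact natCard_quot_commutators_dvd_two_of_forall_exists
    (P := fun α : Q.IsometryEquiv Q ↦ α.IsOrientationPreserving ↔ LinearMap.det (α : V →ₗ[ℤ] V) = 1) hs (ε := 1) (one_mul 1)
    (kerChiDet_refl Q) (kerChiDet_trans Q hs hnd) (kerChiDet_symm Q hs hnd) (fun a ha ↦ kerChiDet_posTwoReflection Q hs hnd a ha)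
    hK hr₀ fun _ _ ha hb ↦ exists_isometryEquiv_prop_apply_eq_of_apply_self_eq Q (kerChiDet_of_specialOrthogonal Q) hs hu he
      h2 h2' (one_mul 1) ha hb

/-- **`|ker(χ·det)^{ab}| = 2` under the opposite-sign Kneser hypothesis** (Thm. 1.3's bound is attained: the class of a
`(+2)`-reflection is not trivial, since commutator words have determinant `1`), for every symmetric even unimodular lattice with
`n± ≥ 2` — the opposite-sign form of "`Õ⁺(L)^{ab} ≅ ℤ/2ℤ`". [cite: GritsenkoHulekSankaran2009, Thm. 1.3, Prop. 1.6 and Cor. 1.2 ("also true with opposite signs")] -/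
theorem natCard_quot_kerChiDet_commutators_eq_two_of_isUnimodular (hs : Q.IsSymm) (hu : Q.IsUnimodular) (he : Q.IsEven)
    (h2 : 2 ≤ sigPos Q.toQuadraticMap) (h2' : 2 ≤ sigNeg Q.toQuadraticMap)
    (hK : ∀ φ : Q.IsometryEquiv Q, (φ.IsOrientationPreserving ↔ LinearMap.det (φ : V →ₗ[ℤ] V) = 1) →
      IsWordIn {ψ : Q.IsometryEquiv Q | ∃ (a : V) (ha : Q a a = 1 + 1), ψ = normTwoReflectionEquiv hs a 1 ha (one_mul 1)} φ) :
    Nat.card (Quot fun φ ρ : {φ : Q.IsometryEquiv Q // φ.IsOrientationPreserving ↔ LinearMap.det (φ : V →ₗ[ℤ] V) = 1} ↦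
      IsWordIn {ψ : Q.IsometryEquiv Q | ∃ α β : Q.IsometryEquiv Q,
        (α.IsOrientationPreserving ↔ LinearMap.det (α : V →ₗ[ℤ] V) = 1) ∧
        (β.IsOrientationPreserving ↔ LinearMap.det (β : V →ₗ[ℤ] V) = 1) ∧ ψ = ((β.symm.trans α.symm).trans β).trans α}
        (φ.1.trans ρ.1.symm)) = 2 := by
  have hnd := hu.nondegenerate
  obtain ⟨x, y, x₁, y₁, hP⟩ := exists_twoHyperbolicPairs_of_isEven_of_isUnimodular Q hs hu he h2 h2'
  have hr₀ : Q (x + (1 : ℤ) • y) (x + (1 : ℤ) • y) = 1 + 1 := hP.apply_self_add_smul 1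
  rcases (Nat.dvd_prime Nat.prime_two).1 (natCard_quot_kerChiDet_commutators_dvd_two_of_isUnimodular Q hs hu he h2 h2' hK)
    with h1 | h2''
  · -- one class would make `σ_{e+f} ≡ 1`, but commutator words have determinant `1`
    exfalso
    obtain ⟨hsub, -⟩ := Nat.card_eq_one_iff_unique.1 h1
    have hequiv : Equivalence fun φ ρ : {φ : Q.IsometryEquiv Q // φ.IsOrientationPreserving ↔
        LinearMap.det (φ : V →ₗ[ℤ] V) = 1} ↦
        IsWordIn {ψ : Q.IsometryEquiv Q | ∃ α β : Q.IsometryEquiv Q,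
          (α.IsOrientationPreserving ↔ LinearMap.det (α : V →ₗ[ℤ] V) = 1) ∧
          (β.IsOrientationPreserving ↔ LinearMap.det (β : V →ₗ[ℤ] V) = 1) ∧ ψ = ((β.symm.trans α.symm).trans β).trans α}
          (φ.1.trans ρ.1.symm) :=
      ⟨fun φ ↦ isWordIn_commutators_trans_self_symm φ.1, fun h ↦ h.commutators_rel_symm, fun h₁ h₂ ↦ h₁.commutators_rel_trans h₂⟩
    have heq := hsub.elim
      (Quot.mk (fun φ ρ : {φ : Q.IsometryEquiv Q // φ.IsOrientationPreserving ↔ LinearMap.det (φ : V →ₗ[ℤ] V) = 1} ↦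
        IsWordIn {ψ : Q.IsometryEquiv Q | ∃ α β : Q.IsometryEquiv Q,
          (α.IsOrientationPreserving ↔ LinearMap.det (α : V →ₗ[ℤ] V) = 1) ∧
          (β.IsOrientationPreserving ↔ LinearMap.det (β : V →ₗ[ℤ] V) = 1) ∧ ψ = ((β.symm.trans α.symm).trans β).trans α}
          (φ.1.trans ρ.1.symm))
        ⟨normTwoReflectionEquiv hs _ 1 hr₀ (one_mul 1), kerChiDet_posTwoReflection Q hs hnd _ hr₀⟩)
      (Quot.mk _ ⟨LinearMap.BilinForm.IsometryEquiv.refl Q, kerChiDet_refl Q⟩)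
    rw [Quot.eq, hequiv.eqvGen_iff] at heq
    have hdet := IsWordIn.det_eq_one_of_commutators_of heq
    rw [IsometryEquiv.det_trans_eq_mul, IsometryEquiv.det_symm_eq, specialOrthogonal_refl.2, one_mul,
      det_normTwoReflectionEquiv _ hs] at hdet
    norm_num at hdet
  · exact h2''

end OppositeSigns

section HyperbolicSum

/-- **Opposite signs for `U^{⊕n}`, `n ≥ 3`, unconditionally: `|ker(χ·det)^{ab}| = 2`** — `ker(χ·det) = ⟨σ_v : v² = +2⟩` by row
g50-#8 (Kneser with opposite signs), the `(+2)`-vectors form one `SO⁺`-orbit, and Thm. 1.3's bound `2` is attained.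
[cite: GritsenkoHulekSankaran2009, Thm. 1.3, Thm. 1.1 and Cor. 1.2 ("also true with opposite signs")] -/
theorem hyperbolicSum_natCard_quot_kerChiDet_commutators_eq_two {n : ℕ} (hn : 3 ≤ n) :
    Nat.card (Quot fun φ ρ : {φ : (hyperbolicSum n).IsometryEquiv (hyperbolicSum n) // φ.IsOrientationPreserving ↔
        LinearMap.det (φ : (Fin n → ℤ) × (Fin n → ℤ) →ₗ[ℤ] (Fin n → ℤ) × (Fin n → ℤ)) = 1} ↦
      IsWordIn {ψ : (hyperbolicSum n).IsometryEquiv (hyperbolicSum n) | ∃ α β : (hyperbolicSum n).IsometryEquiv (hyperbolicSum n),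
        (α.IsOrientationPreserving ↔ LinearMap.det (α : (Fin n → ℤ) × (Fin n → ℤ) →ₗ[ℤ] (Fin n → ℤ) × (Fin n → ℤ)) = 1) ∧
        (β.IsOrientationPreserving ↔ LinearMap.det (β : (Fin n → ℤ) × (Fin n → ℤ) →ₗ[ℤ] (Fin n → ℤ) × (Fin n → ℤ)) = 1) ∧
        ψ = ((β.symm.trans α.symm).trans β).trans α} (φ.1.trans ρ.1.symm)) = 2 := by
  obtain ⟨hp, hm⟩ := sigPos_sigNeg_hyperbolicSum n
  exact natCard_quot_kerChiDet_commutators_eq_two_of_isUnimodular _ (isSymm_hyperbolicSum n) (isUnimodular_hyperbolicSum n)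
    (isEven_hyperbolicSum n) (by omega) (by omega) fun φ hφ ↦ (hyperbolicSum_isWordIn_posTwoReflections_iff hn φ).2 hφ

/-- **One `SO⁺(U^{⊕n})`-orbit of `(2ε)`-vectors, `n ≥ 2`, either sign.** [cite: GritsenkoHulekSankaran2009, Prop. 1.6 (proof)] [cite: GritsenkoHulekSankaran2008Proportionality, Prop. 2.4 (i)] -/
theorem hyperbolicSum_natCard_quot_isometryEquiv_specialOrthogonal_apply_self_eq {n : ℕ} (hn : 2 ≤ n) {ε : ℤ} (hε : ε * ε = 1) :
    Nat.card (Quot fun r s : {r : (Fin n → ℤ) × (Fin n → ℤ) // hyperbolicSum n r r = ε + ε} ↦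
      ∃ φ : (hyperbolicSum n).IsometryEquiv (hyperbolicSum n), (φ.IsOrientationPreserving ∧
        LinearMap.det (φ : (Fin n → ℤ) × (Fin n → ℤ) →ₗ[ℤ] (Fin n → ℤ) × (Fin n → ℤ)) = 1) ∧ φ r.1 = s.1) = 1 := by
  obtain ⟨hp, hm⟩ := sigPos_sigNeg_hyperbolicSum n
  exact natCard_quot_isometryEquiv_specialOrthogonal_apply_self_eq_of_isUnimodular _ (isSymm_hyperbolicSum n)
    (isUnimodular_hyperbolicSum n) (isEven_hyperbolicSum n) (by omega) (by omega) hε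

end HyperbolicSum

end Literature.Topology.FourManifolds

end
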